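import Summits.Ventures.PercRepro.Night2FatZSpine

/-!
# night-2: the two-planes regime at `N = 6` — cross pairs and the top levels

At `N = 6` (`|W ∖ {x}| = 5`) in the NON-DEGENERATE two-planes regime with a three-point spine (`|L ∩ H₀| ≤ 3`) and two
points of `W ∖ {x}` in each plane off the spine, the fair share comes from level `1`, the FOUR CROSS PAIRS at level `3`
(`dload_eq_zero_of_cross_pair`) and the whole levels `4, 5, 6`: a distance-1 load at level `4` needs `rk (G ∖ T) ≥ 3`
with `|G ∖ T| = 2`, a distance-2 line at level `4` has four points on the spine, which carries three
(`dload_eq_zero_of_top_of_spine_le`); `110/221 + 4·(180/221)/15 + 10·(180/221)/35 + 5·(180/221)/70 + (180/221)/126 =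
223.7/221 > 1`.  This is the numerically worst configuration of the regime (kit j323578: `1.320` with three loaded
singletons and four spine-type pairs).  **`basis_pair_fair_fat_of_two_planes_six`**.  Paper `proofs/NIGHT-2-g34.md` §6 (c).
-/

namespace PercRepro.Shadow

open PercRepro.ThmH PercRepro.PerFlat

variable {α : Type*} [DecidableEq α] {M : Matroid α} [M.Finite] {G : Finset α}

/-- **A target missing at most two points of `G` whose level exceeds the number of spine points of `(T ∖ K) ∖ {w₀, x}`
is unloaded** (non-degenerate two-planes regime). -/
theorem dload_eq_zero_of_top_of_spine_le (hG : G ∈ flatsQ M (5 + 1)) (hd : (gr M \ G).card = 2)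
    (hk : kColoops M G = 1) (hs : ∀ e ∈ gr M, ∀ f ∈ gr M, e ≠ f → rkN M {e, f} = 2)
    (hl : ∀ e ∈ gr M, M.Indep {e}) (hfat : (fatClosures M 5 G 2).card ≤ 1) {B₀ : Finset α}
    (hB₀ : B₀ ∈ thinMembers M 5 G) {w₀ x : α} (hD : G \ clF M B₀ = {w₀, x}) {R₁ : Finset α}
    (hR₁V : R₁ ⊆ (G \ coloops M G) \ {w₀, x}) (hR₁2 : rkN M R₁ = 2) (hR₁3 : 3 ≤ R₁.card) {c₂ c₃ : α}
    (hc₂V : c₂ ∈ (G \ coloops M G) \ {w₀, x}) (hc₃V : c₃ ∈ (G \ coloops M G) \ {w₀, x})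
    (hc₂ : c₂ ∉ clF M R₁) (hc₃ : c₃ ∉ clF M (insert c₂ R₁))
    (hcover : ∀ e ∈ (G \ coloops M G) \ {w₀, x}, e ∈ clF M (insert c₂ R₁) ∨ e ∈ clF M (insert c₃ R₁))
    (hnd₂ : 3 ≤ rkN M (((G \ coloops M G) \ {w₀, x}).filter
      (fun e => e ∈ clF M (insert c₂ R₁) ∧ e ∉ clF M R₁)))
    (hnd₃ : 3 ≤ rkN M (((G \ coloops M G) \ {w₀, x}).filter
      (fun e => e ∈ clF M (insert c₃ R₁) ∧ e ∉ clF M R₁)))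
    {B : Finset α} (hB : B ∈ thinMembers M 5 G) (hnP : ¬ bigP M G B) {z : α} (hz : z ∈ G \ clF M B)
    {T : Finset α} (hT : T ∈ tgtSets M 5 G B z) (h2 : (G \ T).card ≤ 2)
    (hspine : (((T \ coloops M G) \ {w₀, x}).filter (fun e => e ∈ clF M R₁)).card + 1 ≤ (T \ insert z B).card) :
    dload M 5 G (bigP M G) (dshGT2 M 5 G) T = 0 := by
  by_contra hload
  have hTG : T ⊆ G := subset_G_of_mem_shadowAt (mem_tgtSets.1 hT).1
  obtain ⟨R, hR, hR2, hR3, hcase⟩ := loaded_fat_target_dichotomy' hG hd hk hs hl hfat hB₀ hD hTG hload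
  rcases hcase with ⟨-, hrk⟩ | ⟨hRc, -, c₂', hc₂'T, c₃', hc₃'T, hc₂', hc₃', hcover'⟩
  · have := rkN_le_card (M := M) (G \ T)
    omega
  · have hRL := line_subset_spine_of_dist_two_of_nondeg hG hs hR₁V hR₁2 hR₁3 hc₂V hc₃V hc₂ hc₃ hcover hnd₂ hnd₃
      hTG hR hR2 hR3 hc₂'T hc₃'T hc₂' hc₃' hcover'
    have hsub : R ⊆ ((T \ coloops M G) \ {w₀, x}).filter (fun e => e ∈ clF M R₁) :=
      fun r hr => Finset.mem_filter.2 ⟨hR hr, hRL hr⟩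
    have hlev := card_sdiff_coloops_eq_level_add_five hG hd hk hB hnP hz hT
    have := Finset.card_le_card hsub
    omega

/-- **Four unloaded level-3 targets from two points of `W ∖ {x}` in each plane off the spine** (the cross pairs). -/
theorem four_le_unloaded_level_three_sum_of_cross (hG : G ∈ flatsQ M (5 + 1)) (hd : (gr M \ G).card = 2)
    (hk : kColoops M G = 1) (hs : ∀ e ∈ gr M, ∀ f ∈ gr M, e ≠ f → rkN M {e, f} = 2)
    (hl : ∀ e ∈ gr M, M.Indep {e}) (hfat : (fatClosures M 5 G 2).card ≤ 1) {B₀ : Finset α}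
    (hB₀ : B₀ ∈ thinMembers M 5 G) {w₀ x : α} (hD : G \ clF M B₀ = {w₀, x}) {R₁ : Finset α}
    (hR₁V : R₁ ⊆ (G \ coloops M G) \ {w₀, x}) (hR₁2 : rkN M R₁ = 2) (hR₁3 : 3 ≤ R₁.card) {c₂ c₃ : α}
    (hc₂V : c₂ ∈ (G \ coloops M G) \ {w₀, x}) (hc₃V : c₃ ∈ (G \ coloops M G) \ {w₀, x})
    (hc₂ : c₂ ∉ clF M R₁) (hc₃ : c₃ ∉ clF M (insert c₂ R₁))
    (hcover : ∀ e ∈ (G \ coloops M G) \ {w₀, x}, e ∈ clF M (insert c₂ R₁) ∨ e ∈ clF M (insert c₃ R₁))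
    (hnd₂ : 3 ≤ rkN M (((G \ coloops M G) \ {w₀, x}).filter
      (fun e => e ∈ clF M (insert c₂ R₁) ∧ e ∉ clF M R₁)))
    (hnd₃ : 3 ≤ rkN M (((G \ coloops M G) \ {w₀, x}).filter
      (fun e => e ∈ clF M (insert c₃ R₁) ∧ e ∉ clF M R₁)))
    {B : Finset α} (hB : B ∈ thinMembers M 5 G) (hnP : ¬ bigP M G B) {z : α} (hz : z ∈ G \ clF M B)
    (hx : x ∈ G \ insert z B) (hN : (G \ insert z B).card = 6)
    {y₂ y₂' y₃ y₃' : α} (hy₂ : y₂ ∈ (G \ insert z B).erase x) (hy₂' : y₂' ∈ (G \ insert z B).erase x)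
    (hy₃ : y₃ ∈ (G \ insert z B).erase x) (hy₃' : y₃' ∈ (G \ insert z B).erase x)
    (hne₂ : y₂ ≠ y₂') (hne₃ : y₃ ≠ y₃')
    (hy₂2 : y₂ ∈ clF M (insert c₂ R₁)) (hy₂L : y₂ ∉ clF M R₁) (hy₂'2 : y₂' ∈ clF M (insert c₂ R₁))
    (hy₂'L : y₂' ∉ clF M R₁) (hy₃3 : y₃ ∈ clF M (insert c₃ R₁)) (hy₃L : y₃ ∉ clF M R₁)
    (hy₃'3 : y₃' ∈ clF M (insert c₃ R₁)) (hy₃'L : y₃' ∉ clF M R₁) :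
    4 * fatTerm 3 1 ≤
      ∑ T ∈ ((tgtSets M 5 G B z).filter
        (fun T => x ∈ T ∧ dload M 5 G (bigP M G) (dshGT2 M 5 G) T = 0)).filter
        (fun T => (T \ insert z B).card = 3),
        capS M 5 G T / ((221 / 360 : ℚ) * ((2 * ((T \ coloops M G).card - 2).choose 4 : ℕ) : ℚ)) := by
  have hd' : (gr M \ G).card ≤ 5 := by omega
  have hBm : B ∈ membersIn M (Uq M (5 + 2) 5) G := (mem_thinMembers.1 hB).1
  have hxQ : x ∉ insert z B := (Finset.mem_sdiff.1 hx).2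
  have hGg : G ⊆ gr M := (mem_flatsQ.1 hG).1
  set F := ((tgtSets M 5 G B z).filter
    (fun T => x ∈ T ∧ dload M 5 G (bigP M G) (dshGT2 M 5 G) T = 0)).filter
    (fun T => (T \ insert z B).card = 3) with hF
  have hterm : ∀ T ∈ F, fatTerm 3 1 ≤
      capS M 5 G T / ((221 / 360 : ℚ) * ((2 * ((T \ coloops M G).card - 2).choose 4 : ℕ) : ℚ)) := by
    intro T hT
    rw [hF, Finset.mem_filter, Finset.mem_filter] at hT
    obtain ⟨⟨hTt, -, -⟩, hTj⟩ := hT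
    have hTK : (T \ coloops M G).card = 3 + 5 := by
      rw [card_sdiff_coloops_eq_level_add_five hG hd hk hB hnP hz hTt, hTj]
    have hGT := card_sdiff_add_card_sdiff_of_mem_tgtSets hTt
    have hcap : (1 : ℚ) ≤ capS M 5 G T := by
      rw [capS_eq_one_of_card_sdiff_le_three hd (by omega)]
    unfold fatTerm
    rw [hTK]
    apply div_le_div_of_nonneg_right hcap
    positivity
  -- a cross pair gives a member of `F`
  have hcross : ∀ u v : α, u ∈ (G \ insert z B).erase x → v ∈ (G \ insert z B).erase x →
      u ∈ clF M (insert c₂ R₁) → u ∉ clF M R₁ → v ∈ clF M (insert c₃ R₁) → v ∉ clF M R₁ →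
      insert z B ∪ {x, u, v} ∈ F := by
    intro u v hu hv hu2 huL hv3 hvL
    have hux : u ≠ x := (Finset.mem_erase.1 hu).1
    have hvx : v ≠ x := (Finset.mem_erase.1 hv).1
    have huv : u ≠ v := by
      intro h'
      subst h'
      exact huL (mem_clF_of_mem_two_planes (hR₁V.trans (fun e he => hGg (Finset.mem_sdiff.1 (Finset.mem_sdiff.1 he).1).1))
        (hGg (Finset.mem_sdiff.1 (Finset.mem_sdiff.1 hc₂V).1).1) (hGg (Finset.mem_sdiff.1 (Finset.mem_sdiff.1 hc₃V).1).1)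
        hc₂ hc₃ hu2 hv3)
    have hXsub : ({x, u, v} : Finset α) ⊆ G \ insert z B := by
      intro e he
      rw [Finset.mem_insert, Finset.mem_insert, Finset.mem_singleton] at he
      rcases he with rfl | rfl | rfl
      · exact hx
      · exact Finset.mem_of_mem_erase hu
      · exact Finset.mem_of_mem_erase hv
    have hTt : insert z B ∪ {x, u, v} ∈ tgtSets M 5 G B z := by
      rw [tgtSets_eq_image hG hBm hz, Finset.mem_image]
      exact ⟨{x, u, v}, Finset.mem_filter.2 ⟨Finset.mem_powerset.2 hXsub, ⟨x, Finset.mem_insert_self _ _⟩⟩, rfl⟩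
    have hsd : (insert z B ∪ {x, u, v}) \ insert z B = {x, u, v} := by
      rw [Finset.union_sdiff_left]
      apply Finset.sdiff_eq_self_of_disjoint
      rw [Finset.disjoint_left]
      intro e he
      exact (Finset.mem_sdiff.1 (hXsub he)).2
    have hc3 : ((insert z B ∪ {x, u, v}) \ insert z B).card = 3 := by
      rw [hsd, Finset.card_insert_of_notMem, Finset.card_pair huv]
      rw [Finset.mem_insert, Finset.mem_singleton, not_or]
      exact ⟨hux.symm, hvx.symm⟩
    have hxT : x ∈ insert z B ∪ {x, u, v} := Finset.mem_union_right _ (Finset.mem_insert_self _ _)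
    have huY : u ∈ ((insert z B ∪ {x, u, v}) \ insert z B).erase x := by
      rw [hsd]
      exact Finset.mem_erase.2 ⟨hux, Finset.mem_insert_of_mem (Finset.mem_insert_self _ _)⟩
    have hvY : v ∈ ((insert z B ∪ {x, u, v}) \ insert z B).erase x := by
      rw [hsd]
      exact Finset.mem_erase.2 ⟨hvx, Finset.mem_insert_of_mem (Finset.mem_insert_of_mem (Finset.mem_singleton_self _))⟩
    have hload := dload_eq_zero_of_cross_pair hG hd hk hs hl hfat hB₀ hD hR₁V hR₁2 hR₁3 hc₂V hc₃V hc₂ hc₃ hcover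
      hnd₂ hnd₃ hB hnP hz hxQ hTt hxT huY hvY hu2 huL hv3 hvL
    rw [hF, Finset.mem_filter, Finset.mem_filter]
    exact ⟨⟨hTt, hxT, hload⟩, hc3⟩
  -- the four targets are distinct
  have hdiff : ∀ u v u' v' : α, u ∈ (G \ insert z B).erase x → v ∈ (G \ insert z B).erase x →
      insert z B ∪ {x, u, v} = insert z B ∪ {x, u', v'} → u ∈ ({u', v'} : Finset α) ∧ v ∈ ({u', v'} : Finset α) := by
    intro u v u' v' hu hv heq
    have hux : u ≠ x := (Finset.mem_erase.1 hu).1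
    have hvx : v ≠ x := (Finset.mem_erase.1 hv).1
    have huQ : u ∉ insert z B := (Finset.mem_sdiff.1 (Finset.mem_of_mem_erase hu)).2
    have hvQ : v ∉ insert z B := (Finset.mem_sdiff.1 (Finset.mem_of_mem_erase hv)).2
    have key : ∀ e : α, e ≠ x → e ∉ insert z B → e ∈ insert z B ∪ {x, u', v'} → e ∈ ({u', v'} : Finset α) := by
      intro e hex heQ he
      simp only [Finset.mem_union, Finset.mem_insert, Finset.mem_singleton] at he ⊢
      rcases he with he | he | he | he
      · exact absurd (Finset.mem_insert.2 he) heQ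
      · exact absurd he hex
      · exact Or.inl he
      · exact Or.inr he
    constructor
    · exact key u hux huQ (heq ▸ Finset.mem_union_right _ (Finset.mem_insert_of_mem (Finset.mem_insert_self _ _)))
    · exact key v hvx hvQ (heq ▸ Finset.mem_union_right _
        (Finset.mem_insert_of_mem (Finset.mem_insert_of_mem (Finset.mem_singleton_self _))))
  -- `y₂ ∉ π₃ ∖ L`, `y₃ ∉ π₂ ∖ L`: a point of `W` is in at most one plane off the spine
  have hR₁g : R₁ ⊆ gr M := hR₁V.trans (fun e he => hGg (Finset.mem_sdiff.1 (Finset.mem_sdiff.1 he).1).1)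
  have hc₂g : c₂ ∈ gr M := hGg (Finset.mem_sdiff.1 (Finset.mem_sdiff.1 hc₂V).1).1
  have hc₃g : c₃ ∈ gr M := hGg (Finset.mem_sdiff.1 (Finset.mem_sdiff.1 hc₃V).1).1
  have hsep : ∀ u v : α, u ∈ clF M (insert c₂ R₁) → u ∉ clF M R₁ → v ∈ clF M (insert c₃ R₁) → u ≠ v := by
    intro u v hu2 huL hv3 h'
    subst h'
    exact huL (mem_clF_of_mem_two_planes hR₁g hc₂g hc₃g hc₂ hc₃ hu2 hv3)
  set S : Finset (Finset α) := {insert z B ∪ {x, y₂, y₃}, insert z B ∪ {x, y₂, y₃'},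
    insert z B ∪ {x, y₂', y₃}, insert z B ∪ {x, y₂', y₃'}} with hS
  have hSF : S ⊆ F := by
    intro T hT
    rw [hS, Finset.mem_insert, Finset.mem_insert, Finset.mem_insert, Finset.mem_singleton] at hT
    rcases hT with rfl | rfl | rfl | rfl
    · exact hcross y₂ y₃ hy₂ hy₃ hy₂2 hy₂L hy₃3 hy₃L
    · exact hcross y₂ y₃' hy₂ hy₃' hy₂2 hy₂L hy₃'3 hy₃'L
    · exact hcross y₂' y₃ hy₂' hy₃ hy₂'2 hy₂'L hy₃3 hy₃L
    · exact hcross y₂' y₃' hy₂' hy₃' hy₂'2 hy₂'L hy₃'3 hy₃'L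
  have h23 : y₂ ≠ y₃ := hsep y₂ y₃ hy₂2 hy₂L hy₃3
  have h23' : y₂ ≠ y₃' := hsep y₂ y₃' hy₂2 hy₂L hy₃'3
  have h2'3 : y₂' ≠ y₃ := hsep y₂' y₃ hy₂'2 hy₂'L hy₃3
  have h2'3' : y₂' ≠ y₃' := hsep y₂' y₃' hy₂'2 hy₂'L hy₃'3
  have hSc : S.card = 4 := by
    rw [hS]
    have n1 : insert z B ∪ {x, y₂, y₃} ∉ ({insert z B ∪ {x, y₂, y₃'}, insert z B ∪ {x, y₂', y₃},
        insert z B ∪ {x, y₂', y₃'}} : Finset (Finset α)) := by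
      simp only [Finset.mem_insert, Finset.mem_singleton, not_or]
      refine ⟨fun h => ?_, fun h => ?_, fun h => ?_⟩
      · have := (hdiff y₂ y₃ y₂ y₃' hy₂ hy₃ h).2
        simp only [Finset.mem_insert, Finset.mem_singleton] at this
        rcases this with h' | h'
        · exact h23 h'.symm
        · exact hne₃ h'
      · have := (hdiff y₂ y₃ y₂' y₃ hy₂ hy₃ h).1
        simp only [Finset.mem_insert, Finset.mem_singleton] at this
        rcases this with h' | h'
        · exact hne₂ h'
        · exact h23 h'
      · have := (hdiff y₂ y₃ y₂' y₃' hy₂ hy₃ h).1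
        simp only [Finset.mem_insert, Finset.mem_singleton] at this
        rcases this with h' | h'
        · exact hne₂ h'
        · exact h23' h'
    have n2 : insert z B ∪ {x, y₂, y₃'} ∉ ({insert z B ∪ {x, y₂', y₃},
        insert z B ∪ {x, y₂', y₃'}} : Finset (Finset α)) := by
      simp only [Finset.mem_insert, Finset.mem_singleton, not_or]
      refine ⟨fun h => ?_, fun h => ?_⟩
      · have := (hdiff y₂ y₃' y₂' y₃ hy₂ hy₃' h).1
        simp only [Finset.mem_insert, Finset.mem_singleton] at this
        rcases this with h' | h'
        · exact hne₂ h'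
        · exact h23 h'
      · have := (hdiff y₂ y₃' y₂' y₃' hy₂ hy₃' h).1
        simp only [Finset.mem_insert, Finset.mem_singleton] at this
        rcases this with h' | h'
        · exact hne₂ h'
        · exact h23' h'
    have n3 : insert z B ∪ {x, y₂', y₃} ≠ insert z B ∪ {x, y₂', y₃'} := by
      intro h
      have := (hdiff y₂' y₃ y₂' y₃' hy₂' hy₃ h).2
      simp only [Finset.mem_insert, Finset.mem_singleton] at this
      rcases this with h' | h'
      · exact h2'3 h'.symm
      · exact hne₃ h'
    rw [Finset.card_insert_of_notMem n1, Finset.card_insert_of_notMem n2, Finset.card_pair n3]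
  have hpos : 0 ≤ fatTerm 3 1 := by
    unfold fatTerm
    positivity
  calc 4 * fatTerm 3 1 = (S.card : ℚ) * fatTerm 3 1 := by rw [hSc]; norm_num
    _ = ∑ _T ∈ S, fatTerm 3 1 := by rw [Finset.sum_const, nsmul_eq_mul]
    _ ≤ ∑ T ∈ S, capS M 5 G T / ((221 / 360 : ℚ) * ((2 * ((T \ coloops M G).card - 2).choose 4 : ℕ) : ℚ)) :=
        Finset.sum_le_sum (fun T hT => hterm T (hSF hT))
    _ ≤ _ := by
        apply Finset.sum_le_sum_of_subset_of_nonneg hSF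
        intro T _ _
        exact div_nonneg (capS_nonneg' hG hd' T) (by positivity)

/-- **The fat case of (FAIR) in the non-degenerate two-planes regime at `N = 6`** with a three-point spine and two
points of `W ∖ {x}` in each plane off the spine: level `1`, the four cross pairs and the levels `4, 5, 6`. -/
theorem basis_pair_fair_fat_of_two_planes_six (hG : G ∈ flatsQ M (5 + 1)) (hd : (gr M \ G).card = 2)
    (hk : kColoops M G = 1) (hs : ∀ e ∈ gr M, ∀ f ∈ gr M, e ≠ f → rkN M {e, f} = 2)
    (hl : ∀ e ∈ gr M, M.Indep {e}) (hfat : (fatClosures M 5 G 2).card ≤ 1)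
    {B₀ : Finset α} (hB₀ : B₀ ∈ thinMembers M 5 G) {w₀ x : α} (hD : G \ clF M B₀ = {w₀, x}) (hne : w₀ ≠ x) {R₁ : Finset α}
    (hR₁V : R₁ ⊆ (G \ coloops M G) \ {w₀, x}) (hR₁2 : rkN M R₁ = 2) (hR₁3 : 3 ≤ R₁.card) {c₂ c₃ : α}
    (hc₂V : c₂ ∈ (G \ coloops M G) \ {w₀, x}) (hc₃V : c₃ ∈ (G \ coloops M G) \ {w₀, x})
    (hc₂ : c₂ ∉ clF M R₁) (hc₃ : c₃ ∉ clF M (insert c₂ R₁))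
    (hcover : ∀ e ∈ (G \ coloops M G) \ {w₀, x}, e ∈ clF M (insert c₂ R₁) ∨ e ∈ clF M (insert c₃ R₁))
    (hnd₂ : 3 ≤ rkN M (((G \ coloops M G) \ {w₀, x}).filter
      (fun e => e ∈ clF M (insert c₂ R₁) ∧ e ∉ clF M R₁)))
    (hnd₃ : 3 ≤ rkN M (((G \ coloops M G) \ {w₀, x}).filter
      (fun e => e ∈ clF M (insert c₃ R₁) ∧ e ∉ clF M R₁)))
    (hL3 : (((G \ coloops M G) \ {w₀, x}).filter (fun e => e ∈ clF M R₁)).card ≤ 3)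
    {B : Finset α} (hB : B ∈ thinMembers M 5 G) (hnP : ¬ bigP M G B) {z : α} (hz : z ∈ G \ clF M B)
    (hl0 : loss M 5 G B z ≠ 0) (hw₀ : w₀ ∈ insert z B) (hx : x ∉ insert z B) (hN : (G \ insert z B).card = 6)
    {y₂ y₂' y₃ y₃' : α} (hy₂ : y₂ ∈ (G \ insert z B).erase x) (hy₂' : y₂' ∈ (G \ insert z B).erase x)
    (hy₃ : y₃ ∈ (G \ insert z B).erase x) (hy₃' : y₃' ∈ (G \ insert z B).erase x)
    (hne₂ : y₂ ≠ y₂') (hne₃ : y₃ ≠ y₃')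
    (hy₂2 : y₂ ∈ clF M (insert c₂ R₁)) (hy₂L : y₂ ∉ clF M R₁) (hy₂'2 : y₂' ∈ clF M (insert c₂ R₁))
    (hy₂'L : y₂' ∉ clF M R₁) (hy₃3 : y₃ ∈ clF M (insert c₃ R₁)) (hy₃L : y₃ ∉ clF M R₁)
    (hy₃'3 : y₃' ∈ clF M (insert c₃ R₁)) (hy₃'L : y₃' ∉ clF M R₁) :
    loss M 5 G B z ≤ rhoL M 5 G B z * lossIncomeH M 5 G (bigP M G) (dshGT2 M 5 G) B z := by
  have hd' : (gr M \ G).card ≤ 5 := by omega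
  have hxG : x ∈ G \ insert z B := by
    refine Finset.mem_sdiff.2 ⟨?_, hx⟩
    have : x ∈ G \ clF M B₀ := by
      rw [hD]
      exact Finset.mem_insert_of_mem (Finset.mem_singleton_self _)
    exact (Finset.mem_sdiff.1 this).1
  -- the levels `4, 5, 6` are unloaded: the spine carries three points
  have htop : ∀ T ∈ tgtSets M 5 G B z, x ∈ T → 4 ≤ (T \ insert z B).card →
      dload M 5 G (bigP M G) (dshGT2 M 5 G) T = 0 := by
    intro T hT _ h4
    have hTG : T ⊆ G := subset_G_of_mem_shadowAt (mem_tgtSets.1 hT).1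
    have hGT := card_sdiff_add_card_sdiff_of_mem_tgtSets hT
    have hsub : ((T \ coloops M G) \ {w₀, x}).filter (fun e => e ∈ clF M R₁) ⊆
        ((G \ coloops M G) \ {w₀, x}).filter (fun e => e ∈ clF M R₁) :=
      Finset.filter_subset_filter _
        (Finset.sdiff_subset_sdiff (Finset.sdiff_subset_sdiff hTG (Finset.Subset.refl _)) (Finset.Subset.refl _))
    have := Finset.card_le_card hsub
    exact dload_eq_zero_of_top_of_spine_le hG hd hk hs hl hfat hB₀ hD hR₁V hR₁2 hR₁3 hc₂V hc₃V hc₂ hc₃ hcover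
      hnd₂ hnd₃ hB hnP hz hT (by omega) (by omega)
  have hl1 := fat_count_level_ge' hG hd hk hB hnP hz hxG (j := 1) (by norm_num)
    (fun T hT _ h1 => dload_eq_zero_of_card_sdiff_le_six hG hd hk hs hl
      (by rw [card_sdiff_coloops_eq_level_add_five hG hd hk hB hnP hz hT, h1]))
  have hl4 := fat_count_level_ge' hG hd hk hB hnP hz hxG (j := 4) (by norm_num)
    (fun T hT hxT h4 => htop T hT hxT (by omega))
  have hl5 := fat_count_level_ge' hG hd hk hB hnP hz hxG (j := 5) (by norm_num)
    (fun T hT hxT h5 => htop T hT hxT (by omega))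
  have hl6 := fat_count_level_ge' hG hd hk hB hnP hz hxG (j := 6) (by norm_num)
    (fun T hT hxT h6 => htop T hT hxT (by omega))
  have hl3 := four_le_unloaded_level_three_sum_of_cross hG hd hk hs hl hfat hB₀ hD hR₁V hR₁2 hR₁3 hc₂V hc₃V hc₂ hc₃
    hcover hnd₂ hnd₃ hB hnP hz hxG hN hy₂ hy₂' hy₃ hy₃' hne₂ hne₃ hy₂2 hy₂L hy₂'2 hy₂'L hy₃3 hy₃L hy₃'3 hy₃'L
  rw [hN] at hl1 hl4 hl5 hl6
  have hg0 : ∀ T ∈ (tgtSets M 5 G B z).filter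
      (fun T => x ∈ T ∧ dload M 5 G (bigP M G) (dshGT2 M 5 G) T = 0),
      0 ≤ capS M 5 G T / ((221 / 360 : ℚ) * ((2 * ((T \ coloops M G).card - 2).choose 4 : ℕ) : ℚ)) :=
    fun T _ => div_nonneg (capS_nonneg' hG hd' T) (by positivity)
  apply basis_pair_fair_of_fat_count_sum hG hd hk hs hl hfat hB₀ hD hne hB hnP hz hl0 hw₀ hx
  have hsum := sum_levels_le_sum hg0 (fun T => (T \ insert z B).card) {1, 3, 4, 5, 6}
  rw [Finset.sum_insert (by decide), Finset.sum_insert (by decide), Finset.sum_insert (by decide),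
    Finset.sum_insert (by decide), Finset.sum_singleton] at hsum
  have hnum : (1 : ℚ) ≤ (((6 - 1).choose (1 - 1) : ℕ) : ℚ) * fatTerm 1 (if 6 - 1 ≤ 3 then 1 else 11 / 18) +
      (4 * fatTerm 3 1 +
      (((6 - 1).choose (4 - 1) : ℕ) : ℚ) * fatTerm 4 (if 6 - 4 ≤ 3 then 1 else 11 / 18) +
      (((6 - 1).choose (5 - 1) : ℕ) : ℚ) * fatTerm 5 (if 6 - 5 ≤ 3 then 1 else 11 / 18) +
      (((6 - 1).choose (6 - 1) : ℕ) : ℚ) * fatTerm 6 (if 6 - 6 ≤ 3 then 1 else 11 / 18)) := by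
    unfold fatTerm
    norm_num [Nat.choose]
  linarith

end PercRepro.Shadow
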